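import Mathlib
import HarnessLib.Audit
import Summits.PneNP.PneNP.Theorems.PstarSharingBound
import Summits.PneNP.PneNP.Theorems.PstarNorUnitCoverTools

/-!
# Centre cycles are large: Assumption A is automatic below twelve outputs (ROUND-24, memo §7 G1 / §9 O1 / §12.1)

FRONTIER range-avoidance ladder, rung F-N3, ROUND 24 (cell `pnp-ideate`, planner memo `r24/CORE-BOUND-NOTES.md` §7 G1 ("centre cycles"), §9 O1,
§12.1 (the sharing bound R0), §13.2; restricted-model proof complexity — nothing here bears on `P` versus `NP`).

The end-to-end theorem `PstarChordBridgeFive.card_le_five_of_terminal` carries ASSUMPTION A: a maximal leaf-peelable `F ⊆ J₀` all of whose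
co-edges are chords (`PstarChordRepair.IsChord`: both AND variables boundary variables of `J₀`).  Such an `F` exists iff the NON-CHORDS of `J₀`
(outputs with an AND variable shared inside `J₀` — the memo's centre edges) form a leaf-peelable (XOR-acyclic) set; the obstruction is a
CENTRE CYCLE: a non-empty leafless set of non-chords.  This file quantifies the obstruction with the sharing bound R0
(`PstarSharingBound.two_mul_card_sharedSlots_le`: an XOR-closed `3/2`-expanding family has at most `#J₀/2` shared AND slots):

* `twelve_le_of_leafless_nonchords` — **a centre cycle forces `#J₀ ≥ 12`.**  If `S ⊆ J₀` is non-empty, leafless and consists of non-chords of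
  the XOR-closed `(r,3/2)`-expanding family `J₀` (`#J₀ ≤ r`; pure typed instance with simple overlaps), then `12 ≤ #J₀`.  Count: `S` is itself
  XOR-closed and expanding, so at most `#S/2` of its AND slots are shared INSIDE `S` (R0 for `S`); every output of `S` has a `J₀`-shared slot, and
  each `J₀`-shared slot of `S` not shared inside `S` is matched by a distinct shared slot OUTSIDE `S` (typedness puts the variable in an AND slot
  there); so `#sharedSlots(J₀) ≥ 2#S − #sharedSlots(S) ≥ 3#S/2`, i.e. `#J₀ ≥ 3#S ≥ 12` when `#S ≥ 4`, while a leafless `S` with three outputs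
  is an XOR triangle (pairwise XOR-adjacent, hence no AND sharing inside by simple overlaps) and gives `#sharedSlots(J₀) ≥ 6` directly;
* `peelable_nonchords_of_card_lt` — hence for `#J₀ < 12` the non-chords of `J₀` are leaf-peelable;
* `exists_maximal_peelable_sup`, `assumptionA_of_card_lt` — and extend to a maximal leaf-peelable `F ⊆ J₀` whose co-edges are all chords:
  **Assumption A holds for every XOR-closed expanding family with fewer than twelve outputs.**

Reading: the O1 obstruction lives only at `#J₀ ≥ 12`, beyond every systematic kit census of the cell (K18/K19: `k ≤ 9`); what the conditional
theorem still assumes for cores of `6 … 11` outputs is privates-unread (O2) alone.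
-/

set_option linter.dupNamespace false -- `Summit.PneNP.PneNP.…`: summit = sub-problem name (D-0017 single-conjunct layout)

open Finset Literature.Computability.Complexity
open Summit.PneNP.PneNP.Theorems.PstarTyped (Typed)
open Summit.PneNP.PneNP.Theorems.PstarSALevel (varSet bdry BoundaryExpanding SimpleOverlap)
open Summit.PneNP.PneNP.Theorems.PstarCentreFree (vars_mem_varSet)
open Summit.PneNP.PneNP.Theorems.PstarChordEndgameTools (not_two_shared)
open Summit.PneNP.PneNP.Theorems.PstarCoreBound (XorClosed)
open Summit.PneNP.PneNP.Theorems.PstarXCore (xpair xverts mem_xpair)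
open Summit.PneNP.PneNP.Theorems.PstarChordRepair (IsChord)
open Summit.PneNP.PneNP.Theorems.PstarSharingBound (mult sharedSlots mult_eq_one_of_mem_bdry two_mul_card_sharedSlots_le)
open Summit.PneNP.PneNP.Theorems.PstarChordBridgeTools (xpdeg)
open Summit.PneNP.PneNP.Theorems.PstarChordBridgeCotree (Peelable mem_xverts_iff_xpdeg_pos card_xverts_le_of_leafless)
open Summit.PneNP.PneNP.Theorems.PstarNorUnitCoverTools (three_le_card_of_leafless)

namespace Summit.PneNP.PneNP.Theorems.PstarChordBridgeCentre

variable {n m : ℕ}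

/-! ## Multiplicities and shared slots -/

/-- Membership in the shared-slot set. -/
theorem mem_sharedSlots {I : LocalMap 4 n m} {J₀ : Finset (Fin m)} {p : Fin m × Fin 4} :
    p ∈ sharedSlots I J₀ ↔ p.1 ∈ J₀ ∧ 2 ≤ p.2.val ∧ 2 ≤ mult I J₀ (I.vars p.1 p.2) := by
  unfold sharedSlots PstarSharingBound.andSlots
  rw [mem_filter, mem_product, mem_filter]
  simp only [mem_univ, true_and]
  rw [and_assoc]

/-- A variable of a member has multiplicity at least one. -/
theorem one_le_mult (I : LocalMap 4 n m) {J : Finset (Fin m)} {f : Fin m} (hf : f ∈ J) {v : Fin n} (hv : v ∈ varSet I f) :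
    1 ≤ mult I J v :=
  card_pos.2 ⟨f, mem_filter.2 ⟨hf, hv⟩⟩

/-- Multiplicity is monotone in the family. -/
theorem mult_mono (I : LocalMap 4 n m) {S J : Finset (Fin m)} (h : S ⊆ J) (v : Fin n) : mult I S v ≤ mult I J v :=
  card_le_card (filter_subset_filter _ h)

/-- Boundary variables are the variables of multiplicity one. -/
theorem mem_bdry_iff_mult (I : LocalMap 4 n m) (J : Finset (Fin m)) (v : Fin n) : v ∈ bdry I J ↔ mult I J v = 1 := by
  unfold PstarSALevel.bdry mult
  rw [mem_filter]
  simp only [mem_univ, true_and]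

/-- A non-chord has an AND slot whose variable is shared in the family. -/
theorem exists_shared_slot_of_not_isChord (I : LocalMap 4 n m) {J₀ : Finset (Fin m)} {f : Fin m} (hf : f ∈ J₀) (h : ¬ IsChord I J₀ f) :
    ∃ s : Fin 4, 2 ≤ s.val ∧ 2 ≤ mult I J₀ (I.vars f s) := by
  unfold PstarChordRepair.IsChord at h
  rw [not_and_or, mem_bdry_iff_mult, mem_bdry_iff_mult] at h
  rcases h with h | h
  · have := one_le_mult I hf (vars_mem_varSet I f 2); exact ⟨2, by decide, by omega⟩
  · have := one_le_mult I hf (vars_mem_varSet I f 3); exact ⟨3, by decide, by omega⟩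

/-- **Leafless families are XOR-closed**: a vertex of XOR slot-degree `≥ 2` lies in two members (purity), so it is no boundary variable. -/
theorem xorClosed_of_leafless (I : LocalMap 4 n m) (hI : I.IsPure xorAndPred) {S : Finset (Fin m)}
    (hL : ∀ w ∈ xverts I S, 2 ≤ xpdeg I S w) : XorClosed I S := by
  classical
  intro f hf s hs hb
  have h01 : I.vars f 0 ≠ I.vars f 1 := fun h => absurd (hI.2 f h) (by decide)
  have hs01 : s = 0 ∨ s = 1 := by
    have h4 : ∀ t : Fin 4, t.val < 2 → t = 0 ∨ t = 1 := by decide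
    exact h4 s hs
  have hw : I.vars f s ∈ xverts I S := by
    unfold PstarXCore.xverts
    rw [mem_biUnion]
    refine ⟨f, hf, (mem_xpair I).2 ?_⟩
    rcases hs01 with rfl | rfl
    · exact Or.inl rfl
    · exact Or.inr rfl
  have h2 := hL _ hw
  have hm : mult I S (I.vars f s) = 1 := mult_eq_one_of_mem_bdry hb
  -- the two XOR-slot fibres are disjoint and lie in the multiplicity fibre
  set w := I.vars f s
  have hsub : (S.filter fun j => I.vars j 0 = w) ∪ (S.filter fun j => I.vars j 1 = w) ⊆ S.filter fun j => w ∈ varSet I j := by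
    intro j hj
    rcases mem_union.1 hj with hj | hj <;> rw [mem_filter] at hj ⊢
    · exact ⟨hj.1, hj.2 ▸ vars_mem_varSet I j 0⟩
    · exact ⟨hj.1, hj.2 ▸ vars_mem_varSet I j 1⟩
  have hdisj : Disjoint (S.filter fun j => I.vars j 0 = w) (S.filter fun j => I.vars j 1 = w) := by
    rw [disjoint_left]
    intro j hj hj'
    rw [mem_filter] at hj hj'
    exact absurd (hI.2 j (hj.2.trans hj'.2.symm)) (by decide)
  have hcard := card_le_card hsub
  rw [card_union_of_disjoint hdisj] at hcard
  change xpdeg I S w ≤ mult I S w at hcard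
  omega

/-- **Typed slots**: an AND-slot variable occurring in another output occupies an AND slot there. -/
theorem exists_and_slot_of_mem (I : LocalMap 4 n m) (hT : Typed I) {f g : Fin m} {s : Fin 4} (hs : 2 ≤ s.val)
    (hv : I.vars f s ∈ varSet I g) : ∃ s' : Fin 4, 2 ≤ s'.val ∧ I.vars g s' = I.vars f s := by
  unfold PstarSALevel.varSet at hv
  obtain ⟨s', -, hs'⟩ := mem_image.1 hv
  by_cases hlt : s'.val < 2
  · exact absurd hs' (hT g f s' s hlt hs)
  · exact ⟨s', by omega, hs'⟩

/-! ## Centre cycles force twelve outputs -/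

/-- **A centre cycle forces `#J₀ ≥ 12`.**  See the module docstring. -/
theorem twelve_le_of_leafless_nonchords (I : LocalMap 4 n m) (hI : I.IsPure xorAndPred) (hT : Typed I) (hS : SimpleOverlap I) {r : ℕ}
    (hB : BoundaryExpanding r I) {J₀ : Finset (Fin m)} (hX : XorClosed I J₀) (hr : J₀.card ≤ r) {S : Finset (Fin m)} (hSJ : S ⊆ J₀)
    (hne : S.Nonempty) (hL : ∀ w ∈ xverts I S, 2 ≤ xpdeg I S w) (hnc : ∀ f ∈ S, ¬ IsChord I J₀ f) : 12 ≤ J₀.card := by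
  classical
  have h4slot : ∀ t : Fin 4, 2 ≤ t.val → t = 2 ∨ t = 3 := by decide
  have hXS : XorClosed I S := xorClosed_of_leafless I hI hL
  have hSr : S.card ≤ r := (card_le_card hSJ).trans hr
  have htS : 2 * (sharedSlots I S).card ≤ S.card := two_mul_card_sharedSlots_le I S hXS (hB S hSr)
  have hσJ : 2 * (sharedSlots I J₀).card ≤ J₀.card := two_mul_card_sharedSlots_le I J₀ hX (hB J₀ hr)
  -- `J₀`-shared slots inside / outside `S`
  set XS := (sharedSlots I J₀).filter fun p => p.1 ∈ S with hXSdef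
  set Xout := (sharedSlots I J₀).filter fun p => ¬ p.1 ∈ S with hXoutdef
  have hsplit : XS.card + Xout.card = (sharedSlots I J₀).card := card_filter_add_card_filter_not _
  -- slots shared inside `S` are `J₀`-shared slots inside `S`
  have hTsub : sharedSlots I S ⊆ XS := by
    intro p hp
    obtain ⟨hp1, hp2, hpm⟩ := mem_sharedSlots.1 hp
    exact mem_filter.2 ⟨mem_sharedSlots.2 ⟨hSJ hp1, hp2, hpm.trans (mult_mono I hSJ _)⟩, hp1⟩
  -- every output of `S` owns a `J₀`-shared slot
  have hcov : S ⊆ XS.image Prod.fst := by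
    intro f hf
    obtain ⟨s, hs2, hsm⟩ := exists_shared_slot_of_not_isChord I (hSJ hf) (hnc f hf)
    exact mem_image.2 ⟨(f, s), mem_filter.2 ⟨mem_sharedSlots.2 ⟨hSJ hf, hs2, hsm⟩, hf⟩, rfl⟩
  have hScard : S.card ≤ XS.card := (card_le_card hcov).trans card_image_le
  -- the externally shared slots of `S` inject into the shared slots outside `S`
  set E := XS \ sharedSlots I S with hEdef
  have hEcard : E.card = XS.card - (sharedSlots I S).card := card_sdiff_of_subset hTsub
  have hTle : (sharedSlots I S).card ≤ XS.card := card_le_card hTsub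
  have hEmem : ∀ p ∈ E, p.1 ∈ S ∧ 2 ≤ p.2.val ∧ 2 ≤ mult I J₀ (I.vars p.1 p.2) ∧ mult I S (I.vars p.1 p.2) ≤ 1 := by
    intro p hp
    rw [hEdef, mem_sdiff] at hp
    obtain ⟨hp, hpn⟩ := hp
    rw [hXSdef, mem_filter] at hp
    obtain ⟨hpJ, hp1⟩ := hp
    obtain ⟨-, hp2, hpm⟩ := mem_sharedSlots.1 hpJ
    refine ⟨hp1, hp2, hpm, ?_⟩
    by_contra hlt
    exact hpn (mem_sharedSlots.2 ⟨hp1, hp2, by omega⟩)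
  have hex : ∀ p ∈ E, ∃ q ∈ Xout, I.vars q.1 q.2 = I.vars p.1 p.2 := by
    intro p hp
    obtain ⟨hp1, hp2, hpm, hpS⟩ := hEmem p hp
    -- an output of `J₀` outside `S` containing the variable
    obtain ⟨g, hgJ, hgv, hgS⟩ : ∃ g ∈ J₀, I.vars p.1 p.2 ∈ varSet I g ∧ g ∉ S := by
      by_contra hno
      push Not at hno
      have hsub : (J₀.filter fun j => I.vars p.1 p.2 ∈ varSet I j) ⊆ S.filter fun j => I.vars p.1 p.2 ∈ varSet I j := by
        intro j hj
        rw [mem_filter] at hj ⊢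
        exact ⟨hno j hj.1 hj.2, hj.2⟩
      have := card_le_card hsub
      change mult I J₀ (I.vars p.1 p.2) ≤ mult I S (I.vars p.1 p.2) at this
      omega
    obtain ⟨s', hs', hgs'⟩ := exists_and_slot_of_mem I hT hp2 hgv
    refine ⟨(g, s'), mem_filter.2 ⟨mem_sharedSlots.2 ⟨hgJ, hs', ?_⟩, hgS⟩, hgs'⟩
    show 2 ≤ mult I J₀ (I.vars g s')
    rw [hgs']; exact hpm
  choose! φ hφ using hex
  have hinj : E.card ≤ Xout.card := by
    refine card_le_card_of_injOn φ (fun p hp => (hφ p hp).1) ?_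
    intro p hp p' hp' heq
    obtain ⟨hp1, hp2, -, hpS⟩ := hEmem p hp
    obtain ⟨hp'1, hp'2, -, -⟩ := hEmem p' hp'
    have hv : I.vars p.1 p.2 = I.vars p'.1 p'.2 := by rw [← (hφ p hp).2, ← (hφ p' hp').2, heq]
    -- same variable, multiplicity one in `S`: same output
    have hf : p.1 = p'.1 := by
      have h1 : p.1 ∈ S.filter fun j => I.vars p.1 p.2 ∈ varSet I j := mem_filter.2 ⟨hp1, vars_mem_varSet I p.1 p.2⟩
      have h2 : p'.1 ∈ S.filter fun j => I.vars p.1 p.2 ∈ varSet I j := mem_filter.2 ⟨hp'1, hv ▸ vars_mem_varSet I p'.1 p'.2⟩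
      exact card_le_one.1 hpS _ h1 _ h2
    -- same output, same AND variable: same slot (purity)
    have hsl : p.2 = p'.2 := by
      by_contra hne
      have hne23 : I.vars p.1 2 ≠ I.vars p.1 3 := fun h => absurd (hI.2 p.1 h) (by decide)
      rw [← hf] at hv
      rcases h4slot p.2 hp2 with h | h <;> rcases h4slot p'.2 hp'2 with h' | h'
      · exact hne (h.trans h'.symm)
      · rw [h, h'] at hv; exact hne23 hv
      · rw [h, h'] at hv; exact hne23 hv.symm
      · exact hne (h.trans h'.symm)
    exact Prod.ext hf hsl
  -- arithmetic: `#shared(J₀) ≥ 2#S − #shared(S) ≥ 3#S/2`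
  have h3 := three_le_card_of_leafless I hI hS hne hL
  by_cases h4 : 4 ≤ S.card
  · omega
  · -- `#S = 3`: an XOR triangle has no AND sharing inside
    have hS3 : S.card = 3 := by omega
    have hXV : (xverts I S).card ≤ S.card := card_xverts_le_of_leafless I hL
    have ht0 : (sharedSlots I S).card = 0 := by
      rw [card_eq_zero, eq_empty_iff_forall_notMem]
      intro p hp
      obtain ⟨hp1, hp2, hpm⟩ := mem_sharedSlots.1 hp
      -- another output of `S` containing the AND variable
      obtain ⟨f', hf'S, hne', hvf'⟩ : ∃ f' ∈ S, f' ≠ p.1 ∧ I.vars p.1 p.2 ∈ varSet I f' := by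
        obtain ⟨a, ha, b, hb, hab⟩ := one_lt_card.1 (show 1 < mult I S (I.vars p.1 p.2) by omega)
        rw [mem_filter] at ha hb
        by_cases haf : a = p.1
        · exact ⟨b, hb.1, fun h => hab (haf.trans h.symm), hb.2⟩
        · exact ⟨a, ha.1, haf, ha.2⟩
      -- the two outputs share an XOR vertex (three vertices, two pairs of two)
      have h01 : ∀ j, I.vars j 0 ≠ I.vars j 1 := fun j h => absurd (hI.2 j h) (by decide)
      have hcard2 : ∀ j, (xpair I j).card = 2 := fun j => by unfold PstarXCore.xpair; exact card_pair (h01 j)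
      have hsub : xpair I p.1 ∪ xpair I f' ⊆ xverts I S := by
        intro w hw
        unfold PstarXCore.xverts
        rw [mem_biUnion]
        rcases mem_union.1 hw with hw | hw
        · exact ⟨p.1, hp1, hw⟩
        · exact ⟨f', hf'S, hw⟩
      have hnd : ¬ Disjoint (xpair I p.1) (xpair I f') := by
        intro hd
        have := card_le_card hsub
        rw [card_union_of_disjoint hd, hcard2, hcard2] at this
        omega
      obtain ⟨w, hw, hw'⟩ := not_disjoint_iff.1 hnd
      -- `w` is an XOR variable, the shared AND variable is different (typed): two shared variables
      have hwv : I.vars p.1 p.2 ≠ w := by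
        rcases (mem_xpair I).1 hw with h | h
        · rw [h]; exact fun h' => hT p.1 p.1 0 p.2 (by decide) hp2 h'.symm
        · rw [h]; exact fun h' => hT p.1 p.1 1 p.2 (by decide) hp2 h'.symm
      have hwS : ∀ {j}, w ∈ xpair I j → w ∈ varSet I j := fun hw => by
        rcases (mem_xpair I).1 hw with h | h
        · rw [h]; exact vars_mem_varSet I _ 0
        · rw [h]; exact vars_mem_varSet I _ 1
      exact not_two_shared I hS (Ne.symm hne') hwv (vars_mem_varSet I p.1 p.2) hvf' (hwS hw) (hwS hw')
    omega

/-! ## Assumption A below twelve outputs -/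

/-- **Below twelve outputs the non-chords are leaf-peelable.** -/
theorem peelable_nonchords_of_card_lt (I : LocalMap 4 n m) (hI : I.IsPure xorAndPred) (hT : Typed I) (hS : SimpleOverlap I) {r : ℕ}
    (hB : BoundaryExpanding r I) {J₀ : Finset (Fin m)} (hX : XorClosed I J₀) (hr : J₀.card ≤ r) (hk : J₀.card < 12) :
    Peelable I (J₀.filter fun f => I.vars f 2 ∉ bdry I J₀ ∨ I.vars f 3 ∉ bdry I J₀) := by
  intro S hSsub hne
  by_contra hno
  push Not at hno
  have hL : ∀ w ∈ xverts I S, 2 ≤ xpdeg I S w := by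
    intro w hw
    have hpos := (mem_xverts_iff_xpdeg_pos I S w).1 hw
    have hne1 := hno w
    omega
  have hnc : ∀ f ∈ S, ¬ IsChord I J₀ f := by
    intro f hf hc
    have hf' := (mem_filter.1 (hSsub hf)).2
    unfold PstarChordRepair.IsChord at hc
    rcases hf' with h | h
    · exact h hc.1
    · exact h hc.2
  have h12 := twelve_le_of_leafless_nonchords I hI hT hS hB hX hr (hSsub.trans (filter_subset _ _)) hne hL hnc
  omega

/-- **Maximal peelable sets above a peelable set**: a peelable `S₀ ⊆ J₀` extends to a peelable `F`, `S₀ ⊆ F ⊆ J₀`, that no peelable subset of `J₀`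
properly contains. -/
theorem exists_maximal_peelable_sup (I : LocalMap 4 n m) {J₀ S₀ : Finset (Fin m)} (hS₀ : S₀ ⊆ J₀) (hP : Peelable I S₀) :
    ∃ F, S₀ ⊆ F ∧ F ⊆ J₀ ∧ Peelable I F ∧ ∀ F', F ⊆ F' → F' ⊆ J₀ → Peelable I F' → F' = F := by
  classical
  let P : Finset (Finset (Fin m)) := J₀.powerset.filter fun F => S₀ ⊆ F ∧ Peelable I F
  have hPne : P.Nonempty := ⟨S₀, mem_filter.2 ⟨mem_powerset.2 hS₀, Subset.refl _, hP⟩⟩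
  obtain ⟨F, hF, hmax⟩ := exists_max_image P Finset.card hPne
  rw [mem_filter, mem_powerset] at hF
  refine ⟨F, hF.2.1, hF.1, hF.2.2, fun F' hFF' hF'J hP' => ?_⟩
  have hle := hmax F' (mem_filter.2 ⟨mem_powerset.2 hF'J, hF.2.1.trans hFF', hP'⟩)
  exact (eq_of_subset_of_card_le hFF' hle).symm

/-- **Assumption A holds below twelve outputs**: an XOR-closed `(r,3/2)`-expanding family with `#J₀ ≤ r`, `#J₀ < 12` (pure typed instance with
simple overlaps) has a maximal leaf-peelable subset `F` all of whose co-edges `J₀ ∖ F` are chords of `J₀`. -/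
theorem assumptionA_of_card_lt (I : LocalMap 4 n m) (hI : I.IsPure xorAndPred) (hT : Typed I) (hS : SimpleOverlap I) {r : ℕ}
    (hB : BoundaryExpanding r I) {J₀ : Finset (Fin m)} (hX : XorClosed I J₀) (hr : J₀.card ≤ r) (hk : J₀.card < 12) :
    ∃ F ⊆ J₀, Peelable I F ∧ (∀ F', F ⊆ F' → F' ⊆ J₀ → Peelable I F' → F' = F) ∧ ∀ e ∈ J₀ \ F, IsChord I J₀ e := by
  classical
  obtain ⟨F, hS₀F, hFJ, hPF, hmax⟩ :=
    exists_maximal_peelable_sup I (filter_subset _ J₀) (peelable_nonchords_of_card_lt I hI hT hS hB hX hr hk)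
  refine ⟨F, hFJ, hPF, hmax, fun e he => ?_⟩
  rw [mem_sdiff] at he
  by_contra hc
  unfold PstarChordRepair.IsChord at hc
  rw [not_and_or] at hc
  exact he.2 (hS₀F (mem_filter.2 ⟨he.1, hc⟩))

end Summit.PneNP.PneNP.Theorems.PstarChordBridgeCentre
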